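import Summits.NavierStokesRegularity.NavierStokesRegularity.Theorems.ExtremiserTransienceNearExtremalTransienceScaling
import Literature.Analysis.FluidPDE.SelfSimilarProofs
import Literature.Analysis.FluidPDE.LerayHopfTimeSlice
import Literature.Analysis.FluidPDE.KNSSLocalSmoothingHolds
import HarnessLib

/-!
# Route `ExtremiserTransience`, crux `NearExtremalTransiencePerFlow` (stmt-NavierStokesRegularity-26567),
# LINE g7-δ «coherent member selection», stub T2 `stub_zoomPackage` — part 3: ZOOM INVARIANCE OF THE DEPLETION DATA

`--supports stmt-NavierStokesRegularity-26567` (helper; LINE δ = `Cruxes/…/Lines/member_selection.lean`, PASS idea-crit-4; unregistered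
stubs ⇒ helper). Author: prover seat `ns-net-p2` (g0).

For the amplitude–space zoom `w(y) = a • v(b • y)` (`a, b > 0`; in T2, `a = (Mb n)⁻¹`, `b = ν/Mb n`) of a field `v` on `ℝ³`:
`curl w = (ab)·(curl v)(b·)` (tree `curl_smul_comp_smul`), `D curl w = (ab²)·(D curl v)(b·)`, `Dw = (ab)·(Dv)(b·)`; hence
`Z(w) = a²b⁻¹ Z(v)`, `P(w) = a²b P(v)`, `J(w) = a³ J(v)`, `sup‖w‖ ≤ a·sup‖v‖`, `√Z(w)√P(w) = a²√Z(v)√P(v)`; so the height-`M`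
efficiency clause of `v` is the height-`aM` efficiency clause of `w` (`efficiency_zoom`), a Taylor bound `Z ≤ Θ₀P` becomes
`Z(w) ≤ (Θ₀/b²)·P(w)` (`taylor_zoom`), non-degeneracy, smoothness, divergence-freeness and finiteness of the `Ḣ¹, Ḣ²` budgets are
preserved (`contDiff_zoom`, `isDivFree_zoom`, `lintegral_iteratedFDeriv_zoom_lt_top`).  Tree inputs: `curl_smul_comp_smul`,
`fderiv_const_smul_comp_smul_apply` (FlatSwirlGauge), `DepletionLadder.integral_comp_smul_three`, `frobeniusNormSq_smul`,
`VectorCalculus.IsDivFree.comp_smul`, `isDivFree_const_smul`, `norm_iteratedFDeriv_comp_smul_le`, `lintegral_comp_space_affine`.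
HONEST FRAMING: scaling bookkeeping; nothing about Navier–Stokes is proved; no summit is proved by a line. [folklore]
-/

noncomputable section

open Set MeasureTheory Function
open scoped InnerProductSpace RealInnerProductSpace ENNReal NNReal ContDiff
open Literature.Analysis.FluidPDE

namespace Summit.NavierStokesRegularity.NavierStokesRegularity.Theorems.ExtremiserTransience

-- the problem directory repeats the summit name (`NavierStokesRegularity/NavierStokesRegularity`)
set_option linter.dupNamespace false

variable {v : EuclideanSpace ℝ (Fin 3) → EuclideanSpace ℝ (Fin 3)} {a b : ℝ}

/-- `D(curl (a • v(b ·))) (x) = (ab²) • (D curl v)(bx)`. [folklore] -/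
theorem fderiv_curl_zoom (v : EuclideanSpace ℝ (Fin 3) → EuclideanSpace ℝ (Fin 3)) (a b : ℝ) (x : EuclideanSpace ℝ (Fin 3)) :
    fderiv ℝ (curl (fun y => a • v (b • y))) x = (a * b * b) • fderiv ℝ (curl v) (b • x) := by
  have h : curl (fun y => a • v (b • y)) = fun y => (a * b) • curl v (b • y) := funext (curl_smul_comp_smul v a b)
  rw [h, fderiv_const_smul_comp_smul_apply]

/-- `D(a • v(b ·)) (x) = (ab) • (Dv)(bx)`. [folklore] -/
theorem fderiv_zoom (v : EuclideanSpace ℝ (Fin 3) → EuclideanSpace ℝ (Fin 3)) (a b : ℝ) (x : EuclideanSpace ℝ (Fin 3)) :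
    fderiv ℝ (fun y => a • v (b • y)) x = (a * b) • fderiv ℝ v (b • x) :=
  fderiv_const_smul_comp_smul_apply v a b x

/-- **Enstrophy under the zoom**: `Z(a • v(b·)) = a² b⁻¹ Z(v)` (`b > 0`). [folklore] -/
theorem enstrophy_zoom (v : EuclideanSpace ℝ (Fin 3) → EuclideanSpace ℝ (Fin 3)) (a : ℝ) (hb : 0 < b) :
    ∫ x, ‖curl (fun y => a • v (b • y)) x‖ ^ 2 = a ^ 2 * b⁻¹ * ∫ x, ‖curl v x‖ ^ 2 := by
  have hpt : ∀ x, ‖curl (fun y => a • v (b • y)) x‖ ^ 2 = (a * b) ^ 2 * (fun y => ‖curl v y‖ ^ 2) (b • x) := by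
    intro x
    rw [curl_smul_comp_smul, norm_smul, Real.norm_eq_abs, mul_pow, sq_abs]
  simp_rw [hpt]
  rw [integral_const_mul, DepletionLadder.integral_comp_smul_three hb (fun y => ‖curl v y‖ ^ 2)]
  field_simp

/-- **Palinstrophy under the zoom**: `P(a • v(b·)) = a² b P(v)` (`b > 0`). [folklore] -/
theorem palinstrophy_zoom (v : EuclideanSpace ℝ (Fin 3) → EuclideanSpace ℝ (Fin 3)) (a : ℝ) (hb : 0 < b) :
    ∫ x, frobeniusNormSq (fderiv ℝ (curl (fun y => a • v (b • y))) x) =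
      a ^ 2 * b * ∫ x, frobeniusNormSq (fderiv ℝ (curl v) x) := by
  have hpt : ∀ x, frobeniusNormSq (fderiv ℝ (curl (fun y => a • v (b • y))) x) =
      (a * b * b) ^ 2 * (fun y => frobeniusNormSq (fderiv ℝ (curl v) y)) (b • x) := by
    intro x
    rw [fderiv_curl_zoom, frobeniusNormSq_smul]
  simp_rw [hpt]
  rw [integral_const_mul, DepletionLadder.integral_comp_smul_three hb (fun y => frobeniusNormSq (fderiv ℝ (curl v) y))]
  field_simp

/-- **Stretching under the zoom**: `J(a • v(b·)) = a³ J(v)` (`b > 0`). [folklore] -/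
theorem stretching_zoom (v : EuclideanSpace ℝ (Fin 3) → EuclideanSpace ℝ (Fin 3)) (a : ℝ) (hb : 0 < b) :
    ∫ x, ⟪curl (fun y => a • v (b • y)) x, fderiv ℝ (fun y => a • v (b • y)) x (curl (fun y => a • v (b • y)) x)⟫_ℝ =
      a ^ 3 * ∫ x, ⟪curl v x, fderiv ℝ v x (curl v x)⟫_ℝ := by
  have hpt : ∀ x, ⟪curl (fun y => a • v (b • y)) x, fderiv ℝ (fun y => a • v (b • y)) x (curl (fun y => a • v (b • y)) x)⟫_ℝ =
      (a * b) ^ 3 * (fun y => ⟪curl v y, fderiv ℝ v y (curl v y)⟫_ℝ) (b • x) := by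
    intro x
    rw [curl_smul_comp_smul, fderiv_zoom, FunLike.coe_smul, Pi.smul_apply, map_smul, real_inner_smul_left,
      real_inner_smul_right, real_inner_smul_right]
    ring
  simp_rw [hpt]
  rw [integral_const_mul, DepletionLadder.integral_comp_smul_three hb (fun y => ⟪curl v y, fderiv ℝ v y (curl v y)⟫_ℝ)]
  field_simp

/-- Height under the zoom: `‖v‖ ≤ M ⇒ ‖a • v(b·)‖ ≤ aM` (`a ≥ 0`). [folklore] -/
theorem norm_zoom_le {M : ℝ} (ha : 0 ≤ a) (hM : ∀ x, ‖v x‖ ≤ M) (y : EuclideanSpace ℝ (Fin 3)) :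
    ‖a • v (b • y)‖ ≤ a * M := by
  rw [norm_smul, Real.norm_eq_abs, abs_of_nonneg ha]
  exact mul_le_mul_of_nonneg_left (hM _) ha

/-- `√Z(w) √P(w) = a² √Z(v) √P(v)` for `w = a • v(b·)` (`b > 0`). [folklore] -/
theorem sqrt_enstrophy_mul_sqrt_palinstrophy_zoom (v : EuclideanSpace ℝ (Fin 3) → EuclideanSpace ℝ (Fin 3)) (a : ℝ)
    (hb : 0 < b) :
    Real.sqrt (∫ x, ‖curl (fun y => a • v (b • y)) x‖ ^ 2) *
        Real.sqrt (∫ x, frobeniusNormSq (fderiv ℝ (curl (fun y => a • v (b • y))) x)) =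
      a ^ 2 * (Real.sqrt (∫ x, ‖curl v x‖ ^ 2) * Real.sqrt (∫ x, frobeniusNormSq (fderiv ℝ (curl v) x))) := by
  have hZ0 : 0 ≤ ∫ x, ‖curl v x‖ ^ 2 := integral_nonneg fun x => sq_nonneg _
  have hP0 : 0 ≤ ∫ x, frobeniusNormSq (fderiv ℝ (curl v) x) := integral_nonneg fun x => frobeniusNormSq_nonneg _
  rw [enstrophy_zoom v a hb, palinstrophy_zoom v a hb, ← Real.sqrt_mul (by positivity), ← Real.sqrt_mul hZ0]
  rw [show a ^ 2 * b⁻¹ * (∫ x, ‖curl v x‖ ^ 2) * (a ^ 2 * b * ∫ x, frobeniusNormSq (fderiv ℝ (curl v) x)) =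
      (a ^ 2) ^ 2 * ((∫ x, ‖curl v x‖ ^ 2) * ∫ x, frobeniusNormSq (fderiv ℝ (curl v) x)) by field_simp]
  rw [Real.sqrt_mul (by positivity), Real.sqrt_sq (by positivity)]

/-- **Efficiency is zoom invariant**: the height-`M` clause `(κ − ε) M √Z √P ≤ |J|` for `v` gives the height-`aM` clause for
`w = a • v(b·)` (`a ≥ 0`, `b > 0`). [folklore] -/
theorem efficiency_zoom (v : EuclideanSpace ℝ (Fin 3) → EuclideanSpace ℝ (Fin 3)) {κ ε M : ℝ} (ha : 0 ≤ a) (hb : 0 < b)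
    (heff : (κ - ε) * M * Real.sqrt (∫ x, ‖curl v x‖ ^ 2) * Real.sqrt (∫ x, frobeniusNormSq (fderiv ℝ (curl v) x)) ≤
      |∫ x, ⟪curl v x, fderiv ℝ v x (curl v x)⟫_ℝ|) :
    (κ - ε) * (a * M) * Real.sqrt (∫ x, ‖curl (fun y => a • v (b • y)) x‖ ^ 2) *
        Real.sqrt (∫ x, frobeniusNormSq (fderiv ℝ (curl (fun y => a • v (b • y))) x)) ≤
      |∫ x, ⟪curl (fun y => a • v (b • y)) x, fderiv ℝ (fun y => a • v (b • y)) x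
        (curl (fun y => a • v (b • y)) x)⟫_ℝ| := by
  rw [mul_assoc ((κ - ε) * (a * M)), sqrt_enstrophy_mul_sqrt_palinstrophy_zoom v a hb, stretching_zoom v a hb, abs_mul,
    abs_of_nonneg (pow_nonneg ha 3)]
  have h := mul_le_mul_of_nonneg_left heff (pow_nonneg ha 3)
  calc (κ - ε) * (a * M) * (a ^ 2 * (Real.sqrt (∫ x, ‖curl v x‖ ^ 2) * Real.sqrt (∫ x, frobeniusNormSq (fderiv ℝ (curl v) x))))
      = a ^ 3 * ((κ - ε) * M * Real.sqrt (∫ x, ‖curl v x‖ ^ 2) * Real.sqrt (∫ x, frobeniusNormSq (fderiv ℝ (curl v) x))) := by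
        ring
    _ ≤ a ^ 3 * |∫ x, ⟪curl v x, fderiv ℝ v x (curl v x)⟫_ℝ| := h

/-- **Taylor bound under the zoom**: `Z(v) ≤ Θ₀ P(v)` gives `Z(w) ≤ (Θ₀/b²) P(w)` for `w = a • v(b·)` (`b > 0`). [folklore] -/
theorem taylor_zoom (v : EuclideanSpace ℝ (Fin 3) → EuclideanSpace ℝ (Fin 3)) (a : ℝ) {Θ₀ : ℝ} (hb : 0 < b)
    (hT : (∫ x, ‖curl v x‖ ^ 2) ≤ Θ₀ * ∫ x, frobeniusNormSq (fderiv ℝ (curl v) x)) :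
    (∫ x, ‖curl (fun y => a • v (b • y)) x‖ ^ 2) ≤
      Θ₀ / b ^ 2 * ∫ x, frobeniusNormSq (fderiv ℝ (curl (fun y => a • v (b • y))) x) := by
  rw [enstrophy_zoom v a hb, palinstrophy_zoom v a hb]
  have h := mul_le_mul_of_nonneg_left hT (show 0 ≤ a ^ 2 * b⁻¹ by positivity)
  calc a ^ 2 * b⁻¹ * (∫ x, ‖curl v x‖ ^ 2) ≤ a ^ 2 * b⁻¹ * (Θ₀ * ∫ x, frobeniusNormSq (fderiv ℝ (curl v) x)) := h
    _ = Θ₀ / b ^ 2 * (a ^ 2 * b * ∫ x, frobeniusNormSq (fderiv ℝ (curl v) x)) := by field_simp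

/-- Non-degeneracy under the zoom (`a, b > 0`). [folklore] -/
theorem sqrt_mul_sqrt_zoom_pos (v : EuclideanSpace ℝ (Fin 3) → EuclideanSpace ℝ (Fin 3)) (ha : 0 < a) (hb : 0 < b)
    (hpos : 0 < Real.sqrt (∫ x, ‖curl v x‖ ^ 2) * Real.sqrt (∫ x, frobeniusNormSq (fderiv ℝ (curl v) x))) :
    0 < Real.sqrt (∫ x, ‖curl (fun y => a • v (b • y)) x‖ ^ 2) *
        Real.sqrt (∫ x, frobeniusNormSq (fderiv ℝ (curl (fun y => a • v (b • y))) x)) := by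
  rw [sqrt_enstrophy_mul_sqrt_palinstrophy_zoom v a hb]; positivity

/-- Smoothness under the zoom. [folklore] -/
theorem contDiff_zoom (hv : ContDiff ℝ ∞ v) (a b : ℝ) : ContDiff ℝ ∞ (fun y => a • v (b • y)) :=
  (hv.comp (contDiff_const_smul b)).const_smul a

/-- Divergence-freeness under the zoom. [folklore] -/
theorem isDivFree_zoom (hv : ContDiff ℝ ∞ v) (hdiv : VectorCalculus.IsDivFree v) (a b : ℝ) :
    VectorCalculus.IsDivFree (fun y => a • v (b • y)) :=
  isDivFree_const_smul (hdiv.comp_smul b) ((hv.differentiable (by simp)).comp (differentiable_id.const_smul b)) a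

/-- Finiteness of the `Ḣᵏ` budget under the zoom (`b > 0`): `∫‖Dᵏv‖² < ∞ ⇒ ∫‖Dᵏ(a • v(b·))‖² < ∞`. [folklore] -/
theorem lintegral_iteratedFDeriv_zoom_lt_top (hv : ContDiff ℝ ∞ v) (a : ℝ) (hb : 0 < b) (k : ℕ)
    (hk : ∫⁻ x, ‖iteratedFDeriv ℝ k v x‖ₑ ^ 2 < ⊤) :
    ∫⁻ x, ‖iteratedFDeriv ℝ k (fun y => a • v (b • y)) x‖ₑ ^ 2 < ⊤ := by
  have hvb : ContDiff ℝ ∞ (fun y => v (b • y)) := hv.comp (contDiff_const_smul b)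
  -- pointwise: `‖Dᵏw(x)‖ ≤ |a| bᵏ ‖Dᵏv(bx)‖`
  have hpt : ∀ x, ‖iteratedFDeriv ℝ k (fun y => a • v (b • y)) x‖ₑ ^ 2 ≤
      ENNReal.ofReal ((|a| * |b| ^ k) ^ 2) * (fun z => ‖iteratedFDeriv ℝ k v z‖ₑ ^ 2) (b • x) := by
    intro x
    have h1 : iteratedFDeriv ℝ k (fun y => a • v (b • y)) x = a • iteratedFDeriv ℝ k (fun y => v (b • y)) x :=
      iteratedFDeriv_const_smul_apply' (hvb.contDiffAt.of_le (by exact_mod_cast le_top))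
    have h2 := norm_iteratedFDeriv_comp_smul_le v hb.ne' k x
    have h3 : ‖iteratedFDeriv ℝ k (fun y => a • v (b • y)) x‖ ≤ |a| * |b| ^ k * ‖iteratedFDeriv ℝ k v (b • x)‖ := by
      rw [h1, norm_smul, Real.norm_eq_abs, mul_assoc]
      exact mul_le_mul_of_nonneg_left h2 (abs_nonneg a)
    have h4 : (‖iteratedFDeriv ℝ k (fun y => a • v (b • y)) x‖ₑ : ℝ≥0∞) ≤
        ENNReal.ofReal (|a| * |b| ^ k) * ‖iteratedFDeriv ℝ k v (b • x)‖ₑ := by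
      rw [← ofReal_norm, ← ofReal_norm, ← ENNReal.ofReal_mul (by positivity)]
      exact ENNReal.ofReal_le_ofReal h3
    calc (‖iteratedFDeriv ℝ k (fun y => a • v (b • y)) x‖ₑ : ℝ≥0∞) ^ 2
        ≤ (ENNReal.ofReal (|a| * |b| ^ k) * ‖iteratedFDeriv ℝ k v (b • x)‖ₑ) ^ 2 := pow_le_pow_left' h4 2
      _ = ENNReal.ofReal ((|a| * |b| ^ k) ^ 2) * ‖iteratedFDeriv ℝ k v (b • x)‖ₑ ^ 2 := by
          rw [mul_pow, ENNReal.ofReal_pow (by positivity)]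
  have hcv : ∫⁻ x, (fun z => ‖iteratedFDeriv ℝ k v z‖ₑ ^ 2) (b • x) =
      ENNReal.ofReal (b ^ Module.finrank ℝ (EuclideanSpace ℝ (Fin 3)))⁻¹ * ∫⁻ x, ‖iteratedFDeriv ℝ k v x‖ₑ ^ 2 := by
    have h := lintegral_comp_space_affine hb (0 : EuclideanSpace ℝ (Fin 3)) (fun z => ‖iteratedFDeriv ℝ k v z‖ₑ ^ 2)
    simpa only [zero_add] using h
  calc ∫⁻ x, ‖iteratedFDeriv ℝ k (fun y => a • v (b • y)) x‖ₑ ^ 2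
      ≤ ∫⁻ x, ENNReal.ofReal ((|a| * |b| ^ k) ^ 2) * (fun z => ‖iteratedFDeriv ℝ k v z‖ₑ ^ 2) (b • x) := lintegral_mono hpt
    _ = ENNReal.ofReal ((|a| * |b| ^ k) ^ 2) * ∫⁻ x, (fun z => ‖iteratedFDeriv ℝ k v z‖ₑ ^ 2) (b • x) := by
        rw [lintegral_const_mul' _ _ ENNReal.ofReal_ne_top]
    _ < ⊤ := by
        rw [hcv]
        exact ENNReal.mul_lt_top ENNReal.ofReal_lt_top (ENNReal.mul_lt_top ENNReal.ofReal_lt_top hk)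

end Summit.NavierStokesRegularity.NavierStokesRegularity.Theorems.ExtremiserTransience

end
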